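import Mathlib.Geometry.Manifold.IsManifold.ExtChartAt
import Mathlib.Geometry.Manifold.MFDeriv.Basic
import HarnessLib

/-!
# Shrinking the charts of a manifold into prescribed open neighbourhoods

Let `M` be a charted space over `H` and let `𝒱 = (V_x)_{x ∈ M}` assign to every point an open
neighbourhood `V_x ∋ x` (`OpenNhdFamily M`; e.g. a member of a given open cover containing `x`, or a
trivialising set of a bundle). The type synonym `ChartShrink 𝒱` is `M` with the SAME topology and the
charted-space structure whose preferred chart at `x` is the chart of `M` at `x` RESTRICTED to `V_x`
(`(chartAt H x).restr V_x`, source `(chartAt H x).source ∩ V_x`). Restrictions of compatible charts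
to open sets are compatible (Mathlib's `restr_mem_maximalAtlas`,
`StructureGroupoid.compatible_of_mem_maximalAtlas`), so every `C^n` / analytic structure of `M` is
inherited (`ChartShrink.instIsManifold`, for ALL models with corners `I` on `H` at once — e.g. both
the complex structure `𝓘(ℂ, E)` and the underlying real structure `𝓘(ℝ, E)` of a complex manifold),
and since a restricted chart has the same underlying map and inverse as the original chart, the
extended charts have the same values (`extChartAt_coe`, `extChartAt_symm_coe`) and **manifold
differentiability of maps out of `M` is literally unchanged** (`mdifferentiableWithinAt_iff` and its
corollaries, by `Iff.rfl`).

The point of the construction (J. M. Lee, *Introduction to Smooth Manifolds* (2013), Lemma 1.35 and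
the remark after Prop. 1.19: restricting the charts of a smooth atlas to open subsets gives an
equivalent atlas, so one may always assume chart domains subordinate to a given open cover): every
theorem of the tree that produces covers by CHART SETS — e.g. the nested chart-convex Leray covers of
the Cartan–Serre finiteness theorem, `exists_nestedChartConvexCovers` / `nonempty_dolbeaultLerayDatum`,
whose members lie in chart sources — yields, applied to `ChartShrink 𝒱`, such covers SUBORDINATE to
`𝒱` (all members of the cover attached to the centre `x` lie in `V_x`), with no change to the proofs.

Everything is proved; the definitions are `OpenNhdFamily`, `ChartShrink` and its instances.

## References

* J. M. Lee, *Introduction to Smooth Manifolds*, 2nd ed., GTM 218 (2013), Ch. 1, Prop. 1.19,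
  Lemma 1.35. [Lee2013]
-/

noncomputable section

open Set Function
open scoped Manifold ContDiff Topology

namespace Literature.Geometry.Manifold

/-- **An assignment of an open neighbourhood `V_x ∋ x` to every point of `M`.** [folklore] -/
structure OpenNhdFamily (M : Type*) [TopologicalSpace M] where
  /-- The neighbourhood `V_x` of `x`. [folklore] -/
  V : M → Set M
  /-- Each `V_x` is open. [folklore] -/
  isOpen : ∀ x, IsOpen (V x)
  /-- `x ∈ V_x`. [folklore] -/
  mem : ∀ x, x ∈ V x

namespace OpenNhdFamily

variable {M : Type*} [TopologicalSpace M]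

/-- The open-neighbourhood family attached to an open cover `U : ι → Set M` and a choice `i x` of a
member containing each point: `V_x = U_{i x}`. [folklore] -/
def ofCover {ι : Type*} (U : ι → Set M) (hU : ∀ i, IsOpen (U i)) (i : M → ι) (hi : ∀ x, x ∈ U (i x)) :
    OpenNhdFamily M where
  V x := U (i x)
  isOpen x := hU (i x)
  mem := hi

/-- The members of `ofCover` (definitional). [folklore] -/
@[simp]
theorem ofCover_V {ι : Type*} (U : ι → Set M) (hU : ∀ i, IsOpen (U i)) (i : M → ι)
    (hi : ∀ x, x ∈ U (i x)) (x : M) : (ofCover U hU i hi).V x = U (i x) :=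
  rfl

/-- The intersection of two open-neighbourhood families. [folklore] -/
def inter (𝒱 𝒲 : OpenNhdFamily M) : OpenNhdFamily M where
  V x := 𝒱.V x ∩ 𝒲.V x
  isOpen x := (𝒱.isOpen x).inter (𝒲.isOpen x)
  mem x := ⟨𝒱.mem x, 𝒲.mem x⟩

/-- The members of the intersection (definitional). [folklore] -/
@[simp]
theorem inter_V (𝒱 𝒲 : OpenNhdFamily M) (x : M) : (𝒱.inter 𝒲).V x = 𝒱.V x ∩ 𝒲.V x :=
  rfl

end OpenNhdFamily

/-- **`M` with its charts shrunk into the neighbourhoods `V_x`**: a type synonym for `M` (same points,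
same topology), charted below by the restricted charts `(chartAt H x).restr V_x` (Lee 2013,
Lemma 1.35: restricting the charts of an atlas to open subsets gives an equivalent atlas).
[cite: Lee2013, Ch. 1, Lemma 1.35] -/
@[nolint unusedArguments]
def ChartShrink {M : Type*} [TopologicalSpace M] (_𝒱 : OpenNhdFamily M) : Type _ := M

namespace ChartShrink

variable {H : Type*} [TopologicalSpace H] {M : Type*} [TopologicalSpace M] (𝒱 : OpenNhdFamily M)

/-- The identification `ChartShrink 𝒱 ≃ M` (the identity). [folklore] -/
def equivOrig : ChartShrink 𝒱 ≃ M := Equiv.refl _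

/-- The topology of `ChartShrink 𝒱` is that of `M`. [folklore] -/
instance instTopologicalSpace : TopologicalSpace (ChartShrink 𝒱) := ‹TopologicalSpace M›
/-- Hausdorffness is inherited from `M`. [folklore] -/
instance [T2Space M] : T2Space (ChartShrink 𝒱) := ‹T2Space M›
/-- Compactness is inherited from `M`. [folklore] -/
instance [CompactSpace M] : CompactSpace (ChartShrink 𝒱) := ‹CompactSpace M›
/-- σ-compactness is inherited from `M`. [folklore] -/
instance [SigmaCompactSpace M] : SigmaCompactSpace (ChartShrink 𝒱) := ‹SigmaCompactSpace M›
/-- Local compactness is inherited from `M`. [folklore] -/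
instance [LocallyCompactSpace M] : LocallyCompactSpace (ChartShrink 𝒱) := ‹LocallyCompactSpace M›
/-- Second countability is inherited from `M`. [folklore] -/
instance [SecondCountableTopology M] : SecondCountableTopology (ChartShrink 𝒱) :=
  ‹SecondCountableTopology M›
/-- Connectedness is inherited from `M`. [folklore] -/
instance [ConnectedSpace M] : ConnectedSpace (ChartShrink 𝒱) := ‹ConnectedSpace M›

variable [ChartedSpace H M]

/-- **The shrunk charted-space structure**: the preferred chart at `x` is `(chartAt H x).restr V_x`, and
the atlas consists of exactly these charts. [cite: Lee2013, Ch. 1, Lemma 1.35] -/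
instance instChartedSpace : ChartedSpace H (ChartShrink 𝒱) where
  atlas := Set.range fun x : M ↦ (@chartAt H _ M _ _ x).restr (𝒱.V x)
  chartAt x := (@chartAt H _ M _ _ x).restr (𝒱.V x)
  mem_chart_source x := by
    rw [OpenPartialHomeomorph.restr_source' _ _ (𝒱.isOpen x)]
    exact ⟨@mem_chart_source H M _ _ _ x, 𝒱.mem x⟩
  chart_mem_atlas x := ⟨x, rfl⟩

/-- The preferred chart of `ChartShrink 𝒱` at `x` is the restricted chart of `M`. [folklore] -/
theorem chartAt_eq (x : ChartShrink 𝒱) :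
    chartAt H x = (chartAt H (equivOrig 𝒱 x)).restr (𝒱.V (equivOrig 𝒱 x)) :=
  rfl

/-- The charts of `ChartShrink 𝒱` are restricted charts of `M`. [folklore] -/
theorem mem_atlas_iff {e : OpenPartialHomeomorph (ChartShrink 𝒱) H} :
    e ∈ atlas H (ChartShrink 𝒱) ↔ ∃ x : M, (chartAt H x).restr (𝒱.V x) = e :=
  Iff.rfl

/-- The preferred chart of `ChartShrink 𝒱` at `x` has the same underlying map as the chart of `M`.
[folklore] -/
theorem coe_chartAt (x : ChartShrink 𝒱) :
    ⇑(chartAt H x) = ⇑(chartAt H (equivOrig 𝒱 x)) :=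
  rfl

/-- … and the same inverse. [folklore] -/
theorem coe_chartAt_symm (x : ChartShrink 𝒱) :
    ⇑(chartAt H x).symm = ⇑(chartAt H (equivOrig 𝒱 x)).symm :=
  rfl

/-- The source of the preferred chart of `ChartShrink 𝒱` at `x` is `(chartAt H x).source ∩ V_x`.
[folklore] -/
theorem chartAt_source (x : ChartShrink 𝒱) :
    (chartAt H x).source = (chartAt H (equivOrig 𝒱 x)).source ∩ 𝒱.V (equivOrig 𝒱 x) :=
  OpenPartialHomeomorph.restr_source' _ _ (𝒱.isOpen _)

/-- In particular the chart sources of `ChartShrink 𝒱` are SUBORDINATE to `𝒱`. [folklore] -/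
theorem chartAt_source_subset (x : ChartShrink 𝒱) :
    (chartAt H x).source ⊆ 𝒱.V (equivOrig 𝒱 x) := by
  rw [chartAt_source]
  exact inter_subset_right

/-- The target of the preferred chart of `ChartShrink 𝒱` at `x` lies in the target of the chart of
`M`. [folklore] -/
theorem chartAt_target_subset (x : ChartShrink 𝒱) :
    (chartAt H x).target ⊆ (chartAt H (equivOrig 𝒱 x)).target := by
  rw [chartAt_eq, OpenPartialHomeomorph.restr_target]
  exact inter_subset_left

section Smooth

variable {𝕜 : Type*} [NontriviallyNormedField 𝕜] {E : Type*} [NormedAddCommGroup E] [NormedSpace 𝕜 E]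
  (I : ModelWithCorners 𝕜 E H) (n : WithTop ℕ∞)

/-- **Every `C^n` structure of `M` is inherited by `ChartShrink 𝒱`** (restrictions of charts of the
maximal atlas to open sets lie in the maximal atlas, Mathlib's `restr_mem_maximalAtlas`, and members
of the maximal atlas are pairwise compatible). This holds for every model with corners on `H`
simultaneously, e.g. for `𝓘(ℂ, E)` and `𝓘(ℝ, E)` on a complex manifold. [cite: Lee2013, Ch. 1, Lemma 1.35] -/
instance instIsManifold [IsManifold I n M] : IsManifold I n (ChartShrink 𝒱) where
  compatible := by
    rintro e e' ⟨x, rfl⟩ ⟨x', rfl⟩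
    have he : (chartAt H x).restr (𝒱.V x) ∈ IsManifold.maximalAtlas I n M :=
      restr_mem_maximalAtlas (contDiffGroupoid n I) (IsManifold.chart_mem_maximalAtlas x) (𝒱.isOpen x)
    have he' : (chartAt H x').restr (𝒱.V x') ∈ IsManifold.maximalAtlas I n M :=
      restr_mem_maximalAtlas (contDiffGroupoid n I) (IsManifold.chart_mem_maximalAtlas x') (𝒱.isOpen x')
    have key := IsManifold.compatible_of_mem_maximalAtlas he he'
    exact key

/-- The extended chart of `ChartShrink 𝒱` at `x` has the same underlying map as that of `M`.
[folklore] -/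
theorem extChartAt_coe (x : ChartShrink 𝒱) :
    ⇑(extChartAt I x) = ⇑(extChartAt I (equivOrig 𝒱 x)) :=
  rfl

/-- … and the same inverse. [folklore] -/
theorem extChartAt_symm_coe (x : ChartShrink 𝒱) :
    ⇑(extChartAt I x).symm = ⇑(extChartAt I (equivOrig 𝒱 x)).symm :=
  rfl

/-- The source of the extended chart of `ChartShrink 𝒱` at `x` is `(extChartAt I x).source ∩ V_x`.
[folklore] -/
theorem extChartAt_source (x : ChartShrink 𝒱) :
    (extChartAt I x).source = (extChartAt I (equivOrig 𝒱 x)).source ∩ 𝒱.V (equivOrig 𝒱 x) := by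
  rw [_root_.extChartAt_source, _root_.extChartAt_source, chartAt_source]

/-- The target of the extended chart of `ChartShrink 𝒱` at `x` lies in that of `M`. [folklore] -/
theorem extChartAt_target_subset (x : ChartShrink 𝒱) :
    (extChartAt I x).target ⊆ (extChartAt I (equivOrig 𝒱 x)).target := by
  intro y hy
  have hy' := (extChartAt I x).map_target hy
  rw [extChartAt_source] at hy'
  have h := (extChartAt I (equivOrig 𝒱 x)).map_source hy'.1
  rw [← extChartAt_coe] at h
  rwa [(extChartAt I x).right_inv hy] at h

/-- The inverse extended chart of `ChartShrink 𝒱` at `x` takes values in `V_x`: chart sets of the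
shrunk structure are subordinate to `𝒱`. [folklore] -/
theorem extChartAt_symm_mem_V (x : ChartShrink 𝒱) {y : E} (hy : y ∈ (extChartAt I x).target) :
    (extChartAt I x).symm y ∈ 𝒱.V (equivOrig 𝒱 x) := by
  have h := (extChartAt I x).map_target hy
  rw [extChartAt_source] at h
  exact h.2

variable {E' : Type*} [NormedAddCommGroup E'] [NormedSpace 𝕜 E'] {H' : Type*} [TopologicalSpace H']
  {I' : ModelWithCorners 𝕜 E' H'} {N : Type*} [TopologicalSpace N] [ChartedSpace H' N]

/-- **Manifold differentiability within a set at a point is unchanged by shrinking the charts** (the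
definition only involves the underlying maps of the charts and their inverses, which are the same).
[cite: Lee2013, Ch. 1, Lemma 1.35] -/
theorem mdifferentiableWithinAt_iff {f : M → N} {s : Set M} {x : M} :
    MDifferentiableWithinAt (M := ChartShrink 𝒱) I I' f s x ↔ MDifferentiableWithinAt I I' f s x :=
  ⟨fun h ↦ ⟨h.1, h.2⟩, fun h ↦ ⟨h.1, h.2⟩⟩

/-- Manifold differentiability on a set is unchanged by shrinking the charts. [cite: Lee2013, Ch. 1, Lemma 1.35] -/
theorem mdifferentiableOn_iff {f : M → N} {s : Set M} :
    MDifferentiableOn (M := ChartShrink 𝒱) I I' f s ↔ MDifferentiableOn I I' f s :=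
  forall₂_congr fun _ _ ↦ mdifferentiableWithinAt_iff 𝒱 I

/-- Manifold differentiability at a point is unchanged by shrinking the charts. [cite: Lee2013, Ch. 1, Lemma 1.35] -/
theorem mdifferentiableAt_iff {f : M → N} {x : M} :
    MDifferentiableAt (M := ChartShrink 𝒱) I I' f x ↔ MDifferentiableAt I I' f x :=
  ⟨fun h ↦ ⟨h.1, h.2⟩, fun h ↦ ⟨h.1, h.2⟩⟩

/-- Manifold differentiability is unchanged by shrinking the charts. [cite: Lee2013, Ch. 1, Lemma 1.35] -/
theorem mdifferentiable_iff {f : M → N} :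
    MDifferentiable (M := ChartShrink 𝒱) I I' f ↔ MDifferentiable I I' f :=
  forall_congr' fun _ ↦ mdifferentiableAt_iff 𝒱 I

end Smooth

end ChartShrink

end Literature.Geometry.Manifold
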